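import Mathlib.RingTheory.Derivation.Basic
import Literature.AlgebraicGeometry.Resolution.MarkedIdeals

/-!
# Kummer normal form of the radicand of a purely inseparable `p`-cyclic cover (after Giraud 1983)

Topic: `Literature/AlgebraicGeometry/Resolution`. Definitions only (no theorems): the KUMMER NORMAL
FORM of the radicand of a purely inseparable `p`-cyclic cover `T^p = a` at a point of a regular
base, relative to an snc boundary — the terminal state that Giraud's condition (**) produces (Giraud 1983, Déf. 1.2 and Prop. 1.5: after blow-ups
in regular centres, `a = g^p + x^A · u` with `x` part of a `p`-basis, `u` a unit or
differentially free) and from which the cover is resolved by its normalisation plus a log blow-up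
(regular over the wound/transversal points, toric = log regular over the Kummer points).

* `KummerNormalFormAt p x a` — for a commutative ring `O`, a family `x : Fin r → O` (the local
  equations of the boundary components through the point) and `a ∈ O`: EITHER
  `a = g^p + (∏ x_j^{B_j})^p · u` with `D u` a unit for some derivation `D` of `O` logarithmic
  along the `x_j` (`x_j ∣ D x_j`) — the wound/transversal exit — OR `a = g^p + u · ∏ x_j^{A_j}`
  with `u` a unit and some `A_j` prime to `p` — the Kummer/toric exit.
* `InKummerNormalForm p W π a E` — for a scheme `W` over `Spec R` (via `π`), `a ∈ R` and a list
  `E` of ideal sheaves (the boundary): at every `w ∈ W`, for some enumeration `D` of the members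
  of `E` through `w` and generators `x_j` of their stalk ideals, the germ of `π^* a` at `w` is in
  Kummer normal form with respect to `(x_j)`.

Design notes. (1) The boundary is part of the data (the toric directions must be boundary
components), so that the normalised cover carries ONE global log structure (`π⁻¹E`) and
Kato–Nizioł applies globally; Giraud's "differentially free" alternative `a = g^p + x^A u`, `u` a
transversal coordinate, is reached from this stricter form by finitely many further blow-ups of
the codimension-two regular centres `{x_j = u = 0}`. (2) The derivation in the first alternative
is logarithmic so that the boundary stays snc on the (regular) normalised cover. (3) Nothing here
asserts regularity of `O` or that `x` is part of a regular system of parameters: statements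
using these predicates (e.g. the line `SketchIdeator3` of the summit crux `PicoverLocalModel`,
whose endgame and residue stubs are phrased with them) carry `Scheme.IsRegular W` and `HasSNC E`
separately. (4) What is NOT here: Giraud's log-Jacobian ideal `J(W, a, E)` and condition (**)
themselves (they need logarithmic derivations of `𝒪_W` along `E` as a sheaf), log structures,
log regularity.

References: J. Giraud, *Forme normale d'une fonction sur une surface de caractéristique
positive*, Bull. SMF 111 (1983) 109–124, Déf. 1.2, Prop. 1.5. [Giraud1983]
-/

noncomputable section

open CategoryTheory AlgebraicGeometry TopologicalSpace

namespace Literature.AlgebraicGeometry.Resolution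

/-- **Kummer normal form** of an element `a` of a commutative ring `O` (a local ring of a regular
scheme of characteristic `p`, in the applications) at the exponent `p`, with respect to a family
`x : Fin r → O` (the local equations of the boundary components through the point). EITHER the
wound/transversal exit: `a = g^p + (∏ j, x_j^{B_j})^p · u` where some derivation `D : O → O`,
logarithmic along every `x_j` (`x_j ∣ D x_j`), takes `u` to a unit — then the normalised cover
`t'^p = u`, `t' = (t - g)/∏ x_j^{B_j}`, is regular with the boundary still snc; OR the
Kummer/toric exit: `a = g^p + u · ∏ j, x_j^{A_j}` with `u` a unit and some exponent `A_j` prime to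
`p` — then after the Kummer twist the normalised cover is the toric `w^p = ∏ x_j^{A_j mod p}`,
log regular for the boundary. The local output of Giraud's condition (**) (Giraud 1983, Déf. 1.2,
Prop. 1.5), in a stricter boundary-adapted form (toric directions are boundary components).
[cite: Giraud1983, Prop. 1.5] -/
def KummerNormalFormAt (p : ℕ) {O : Type*} [CommRing O] {r : ℕ} (x : Fin r → O) (a : O) : Prop :=
  (∃ (g u : O) (B : Fin r → ℕ) (D : Derivation ℤ O O),
      (∀ j, x j ∣ D (x j)) ∧ IsUnit (D u) ∧ a = g ^ p + (∏ j, x j ^ B j) ^ p * u) ∨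
  (∃ (g : O) (A : Fin r → ℕ) (u : Oˣ), (∃ j, ¬ p ∣ A j) ∧ a = g ^ p + (u : O) * ∏ j, x j ^ A j)

/-- **`π^* a` is in Kummer normal form along the boundary `E` at every point of `W`.** For a
scheme `W` with a morphism `π : W → Spec R`, an element `a ∈ R` and a list `E` of ideal sheaves on
`W` (the boundary components; `HasSNC E` in the applications): at each `w ∈ W` there are an
enumeration `D : Fin r ≃ {D ∈ E | w ∈ supp D}` of the boundary components through `w` and
generators `x_j` of their stalk ideals `(D_j)_w = (x_j) ⊆ 𝒪_{W,w}` such that the germ at `w` of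
the global section `π^* a` is in Kummer normal form with respect to `(x_j)_j`
(`KummerNormalFormAt`). [folklore] -/
def InKummerNormalForm (p : ℕ) {R : Type} [CommRing R] (W : Scheme.{0}) (π : W ⟶ Spec (.of R))
    (a : R) (E : List W.IdealSheafData) : Prop :=
  ∀ w : W, ∃ (r : ℕ) (D : Fin r → {D : W.IdealSheafData // D ∈ E ∧ w ∈ D.support})
    (x : Fin r → W.presheaf.stalk w), Function.Bijective D ∧
      (∀ j, stalkIdeal (D j).1 w = Ideal.span {x j}) ∧
      KummerNormalFormAt p x
        ((W.presheaf.germ ⊤ w trivial) (π.appTop ((Scheme.ΓSpecIso (.of R)).inv a)))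


/-! ## The intrinsic (derivation-free) form of the wound/transversal exit

The first alternative of `KummerNormalFormAt` asks for a derivation logarithmic along the
boundary taking `u` to a unit. What the endgame actually consumes at the point is weaker and
intrinsic: with `𝔪` the maximal ideal and `κ = O/𝔪`, EITHER `ū ∉ κ^p` (the *wound* case: then
`O[t']/(t'^p - u)` is local with maximal ideal `𝔪 O[t']`, hence regular of the same dimension,
and the boundary stays snc by flatness) OR `u ≡ c^p (mod 𝔪)` for some `c` and the class of
`u - c^p` in the cotangent space `𝔪/𝔪²` is non-zero and independent of the classes of the
boundary equations `x_j` (the *transversal* case: then `t' - c` replaces that cotangent direction,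
`O[t']/(t'^p - u)` is regular and the `x_j` stay part of a regular system of parameters). A
logarithmic derivation with `D u` a unit forces this condition in characteristic `p`
(`KummerNormalFormAt.giraudNormalFormAt` below), but not conversely (derivations of `κ` need not lift
to `O`), so the `Giraud…` predicates below are the WEAKER normal form — the better residue for the
same endgame. -/

/-- **Wound-or-transversal condition** for an element `u` of a local ring `O` at the exponent `p`,
relative to boundary equations `x : Fin r → O`: EITHER `u - c^p` is a unit for every `c`
(`ū ∉ κ^p`, wound) OR for some `c`, `u - c^p` lies in the maximal ideal `𝔪` but not in
`𝔪² + (x_1, …, x_r)` (transversal to the boundary). This is exactly the condition under which the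
purely inseparable cover `t^p = u` of `Spec O` is regular over the closed point with the boundary
`V(∏ x_j)` still a simple normal crossings divisor. [folklore] -/
def IsWoundOrTransversalAt (p : ℕ) {O : Type*} [CommRing O] [IsLocalRing O] {r : ℕ}
    (x : Fin r → O) (u : O) : Prop :=
  (∀ c : O, u - c ^ p ∉ IsLocalRing.maximalIdeal O) ∨
  (∃ c : O, u - c ^ p ∈ IsLocalRing.maximalIdeal O ∧
    u - c ^ p ∉ IsLocalRing.maximalIdeal O ^ 2 ⊔ Ideal.span (Set.range x))

/-- **Giraud normal form** (intrinsic, boundary-adapted) of `a ∈ O`, `O` local of characteristic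
`p`, relative to boundary equations `x : Fin r → O`: EITHER `a = g^p + (∏ j, x_j^{B_j})^p · u`
with `u` wound-or-transversal (`IsWoundOrTransversalAt`) — the normalised cover
`t'^p = u`, `t' = (t - g)/∏ x_j^{B_j}`, is then regular with snc boundary — OR
`a = g^p + u · ∏ j, x_j^{A_j}` with `u` a unit and some `A_j` prime to `p` (Kummer/toric exit).
Giraud 1983, Prop. 1.5 gives `a = g^p + x^A u` with `u` a unit or `(x, u)` differentially free;
this is its derivation-free rendering with toric directions required to be boundary components.
[cite: Giraud1983, Prop. 1.5] -/
def GiraudNormalFormAt (p : ℕ) {O : Type*} [CommRing O] [IsLocalRing O] {r : ℕ} (x : Fin r → O)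
    (a : O) : Prop :=
  (∃ (g u : O) (B : Fin r → ℕ), IsWoundOrTransversalAt p x u ∧ a = g ^ p + (∏ j, x j ^ B j) ^ p * u) ∨
  (∃ (g : O) (A : Fin r → ℕ) (u : Oˣ), (∃ j, ¬ p ∣ A j) ∧ a = g ^ p + (u : O) * ∏ j, x j ^ A j)

/-- **`π^* a` is in Giraud normal form along the boundary `E` at every point of `W`**: as
`InKummerNormalForm`, with the intrinsic `GiraudNormalFormAt` at each stalk (stalks of a scheme
are local rings). [folklore] -/
def InGiraudNormalForm (p : ℕ) {R : Type} [CommRing R] (W : Scheme.{0}) (π : W ⟶ Spec (.of R))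
    (a : R) (E : List W.IdealSheafData) : Prop :=
  ∀ w : W, ∃ (r : ℕ) (D : Fin r → {D : W.IdealSheafData // D ∈ E ∧ w ∈ D.support})
    (x : Fin r → W.presheaf.stalk w), Function.Bijective D ∧
      (∀ j, stalkIdeal (D j).1 w = Ideal.span {x j}) ∧
      GiraudNormalFormAt p x
        ((W.presheaf.germ ⊤ w trivial) (π.appTop ((Scheme.ΓSpecIso (.of R)).inv a)))

/-- A derivation of a local ring maps `𝔪²` into `𝔪` (Leibniz rule). [folklore] -/
theorem derivation_apply_mem_maximalIdeal_of_mem_sq {O : Type*} [CommRing O] [IsLocalRing O]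
    (D : Derivation ℤ O O) {q : O} (hq : q ∈ IsLocalRing.maximalIdeal O ^ 2) :
    D q ∈ IsLocalRing.maximalIdeal O := by
  rw [pow_two] at hq
  refine Submodule.mul_induction_on hq (fun m hm n hn => ?_) (fun y z hy hz => ?_)
  · rw [Derivation.leibniz, smul_eq_mul, smul_eq_mul]
    exact Ideal.add_mem _ (Ideal.mul_mem_right _ _ hm) (Ideal.mul_mem_right _ _ hn)
  · rw [map_add]
    exact Ideal.add_mem _ hy hz

/-- **A logarithmic derivation with `D u` a unit forces the wound-or-transversal condition** (in
characteristic `p`, boundary equations in `𝔪`): if `u ≡ c^p (mod 𝔪)` and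
`u - c^p ∈ 𝔪² + (x)`, then `D u = D (u - c^p) ∈ D(𝔪²) + D((x)) ⊆ 𝔪` (Leibniz, `x_j ∣ D x_j`,
`D (c^p) = p c^{p-1} D c = 0`), contradicting `IsUnit (D u)`. Hence `KummerNormalFormAt`
implies `GiraudNormalFormAt` at points where the boundary equations are non-units. [folklore] -/
theorem isWoundOrTransversalAt_of_derivation (p : ℕ) {O : Type*} [CommRing O] [IsLocalRing O]
    [CharP O p] {r : ℕ} (x : Fin r → O) (hx : ∀ j, x j ∈ IsLocalRing.maximalIdeal O) (u : O)
    (D : Derivation ℤ O O) (hlog : ∀ j, x j ∣ D (x j)) (hu : IsUnit (D u)) :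
    IsWoundOrTransversalAt p x u := by
  classical
  by_cases h : ∃ c : O, u - c ^ p ∈ IsLocalRing.maximalIdeal O
  · obtain ⟨c, hc⟩ := h
    refine Or.inr ⟨c, hc, fun hmem => ?_⟩
    have hDc : D (c ^ p) = 0 := by
      rw [Derivation.leibniz_pow, nsmul_eq_mul, CharP.cast_eq_zero O p, zero_mul]
    have hDu : D (u - c ^ p) = D u := by rw [map_sub, hDc, sub_zero]
    have hspan : Ideal.span (Set.range x) ≤ IsLocalRing.maximalIdeal O :=
      Ideal.span_le.mpr (by rintro _ ⟨j, rfl⟩; exact hx j)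
    have key : ∀ s ∈ IsLocalRing.maximalIdeal O ^ 2 ⊔ Ideal.span (Set.range x),
        D s ∈ IsLocalRing.maximalIdeal O := by
      intro s hs
      obtain ⟨q, hq, t, ht, rfl⟩ := Submodule.mem_sup.mp hs
      rw [map_add]
      refine Ideal.add_mem _ (derivation_apply_mem_maximalIdeal_of_mem_sq D hq) ?_
      refine Submodule.span_induction (p := fun t _ => D t ∈ IsLocalRing.maximalIdeal O)
        ?_ ?_ ?_ ?_ ht
      · rintro _ ⟨j, rfl⟩
        obtain ⟨e, he⟩ := hlog j
        rw [he]
        exact Ideal.mul_mem_right _ _ (hx j)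
      · simp
      · intro a b _ _ ha hb
        rw [map_add]
        exact Ideal.add_mem _ ha hb
      · intro a b hb ih
        rw [smul_eq_mul, Derivation.leibniz, smul_eq_mul, smul_eq_mul]
        exact Ideal.add_mem _ (Ideal.mul_mem_left _ _ ih) (Ideal.mul_mem_right _ _ (hspan hb))
    have hmem' : D u ∈ IsLocalRing.maximalIdeal O := hDu ▸ key _ hmem
    exact (IsLocalRing.mem_maximalIdeal _).mp hmem' hu
  · push Not at h
    exact Or.inl h

/-- `KummerNormalFormAt` implies `GiraudNormalFormAt` in a local ring of characteristic `p` whose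
boundary equations lie in the maximal ideal. [folklore] -/
theorem KummerNormalFormAt.giraudNormalFormAt {p : ℕ} {O : Type*} [CommRing O] [IsLocalRing O]
    [CharP O p] {r : ℕ} {x : Fin r → O} (hx : ∀ j, x j ∈ IsLocalRing.maximalIdeal O) {a : O}
    (h : KummerNormalFormAt p x a) : GiraudNormalFormAt p x a := by
  rcases h with ⟨g, u, B, D, hlog, hu, ha⟩ | ⟨g, A, u, hA, ha⟩
  · exact Or.inl ⟨g, u, B, isWoundOrTransversalAt_of_derivation p x hx u D hlog hu, ha⟩
  · exact Or.inr ⟨g, A, u, hA, ha⟩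

end Literature.AlgebraicGeometry.Resolution

end
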